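import Literature.Geometry.Riemannian.ShrinkerEntropyAllScales
import Literature.Geometry.Riemannian.ShrinkerEntropyAllScalesMonotonicity
import Literature.Geometry.Riemannian.ShrinkerEntropyAllScalesReduction
import Literature.Geometry.Riemannian.WeightedHeatSemigroupComplete
import Literature.Geometry.Riemannian.ShrinkerScalarCurvatureNonnegHolds
import Literature.Geometry.Riemannian.ShrinkerPotentialGrowthProofs
import HarnessLib

/-!
# Li–Wang 2020, Thm. 1.1 (all-scales LSI of a shrinker) from the weighted heat semigroup / heat flow

Proof layer of the named fact `LiWang2020_shrinkerLSI_allScales` (`ShrinkerEntropyAllScales.lean`;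
Y. Li, B. Wang, *Heat kernel on Ricci shrinkers*, Calc. Var. PDE 59 (2020) = arXiv:1901.05691,
Thm. 1.1 = Prop. 5.9 with Lemma 5.10): the fact is REDUCED to the existence of the weighted heat
semigroup of a complete `CD(K, ∞)` manifold with its strong gradient bound
(`weightedHeatSemigroup_strongGradientBound_complete`, Bakry–Gentil–Ledoux 2014, Thm. 3.2.4) — the
same and only input behind the tree's reduction of `bakryEmery_logSobolev_complete`
(`BakryEmeryLogSobolevSemigroup.lean`), i.e. the parabolic theory of Li–Wang's §§2–3 in semigroup
form. Assembly:

* `LiWang2020.log_le_wEntropy_of_asei` — the algebra of Carrillo–Ni's §4 at scale `τ`: from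
  `∫ (f + c − ψ) u ≤ τ ∫ |∇(f − ψ)|² u + (1 − τ)(∫ f u − n)` for the density
  `u = (4πτ)^{-n/2} e^{-ψ}`, the soliton identities and the integration by parts
  `∫ g⁻¹(df, dψ) u = ∫ u Δf`, to `c ≤ 𝒲(g, ψ, τ)`;
* `LiWang2020.log_le_wEntropy_of_dim_zero` — the degenerate case `n = 0` (a point);
* `LiWang2020_shrinkerLSI_allScales_of_heatSemigroup` — the fact from the semigroup: `R ≥ 0`
  (`shrinkerScalarCurvature_nonneg_holds`), the potential is proper (Haslhofer–Müller growth,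
  `ShrinkerPotentialGrowthProofs.lean`), `e^{-f}, f e^{-f} ∈ L¹`; the probability potential
  `V = f + log ∫e^{-f}` has `Ric + Hess V = g/2`; the semigroup of `(M, g, e^{-V})` feeds the
  static-frame Perelman monotonicity `shrinker_asei_eventuallyConst_of_semigroup`
  (`ShrinkerEntropyAllScalesMonotonicity.lean`), extended to the fact's class by
  `shrinker_asei_of_asei_eventuallyConst` (`ShrinkerEntropyAllScalesReduction.lean`) applied to
  `φ = f + log Θ − ψ − (n/2) log τ` (`e^{φ − V} = u`), and `log_le_wEntropy_of_asei` concludes;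
* `LiWang2020.log_le_wEntropy_of_heatFlow` and `LiWang2020_shrinkerLSI_allScales_of_heatFlow` — the
  same conclusion (on one shrinker, resp. the fact) from the WEAKEST form of the analytic input: for
  every smooth positive datum `ρ₀` constant outside a compact set, a solution `u` of the weighted heat
  equation `∂ₜu = Δu − g⁻¹(df, du)` on the shrinker, jointly smooth on `M × [0, ∞)`, with values in
  the range of `ρ₀`, `|Lu|` bounded, gradient decay `|∇u(t)|² ≤ e^{-t}C` and conserved `∫ u e^{-f}`
  (via `shrinker_asei_eventuallyConst_of_flow`) — so that ANY construction of the weighted heat flow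
  on the complete shrinker (Li–Wang's §§2–3; the semigroup above is one) discharges the fact.

Theorems only; no definitions, no named facts (D-0026).

## References

* [LiWang2020] Y. Li, B. Wang, Calc. Var. PDE 59 (2020) no. 194 (arXiv:1901.05691): Thm. 1.1
  (p. 3), §4 (4.3)–(4.4) (p. 14), (5.1), Thm. 5.4, Prop. 5.7, Prop. 5.9, Lemma 5.10 (pp. 18–20).
  READ (held text paper:arxiv-1901.05691).
* [CarrilloNi2009] J. A. Carrillo, L. Ni, Comm. Anal. Geom. 17 (2009), §4 (the case `τ = 1`).
* [BakryGentilLedoux2014] D. Bakry, I. Gentil, M. Ledoux, Springer 2014, Thm. 3.2.4, Prop. 5.7.1.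
* [HaslhoferMuller2011] R. Haslhofer, R. Müller, GAFA 21 (2011), Lemma 2.1 and (2.6).
-/

noncomputable section

open Bundle Set Function Filter Module Manifold MeasureTheory
open scoped Manifold ContDiff Topology ENNReal NNReal

namespace Literature.Geometry.Riemannian

open Lorentzian Lorentzian.PseudoRiemannianMetric CarrilloNi2009_shrinkerLSI

namespace LiWang2020

/-! ### Carrillo–Ni's §4 at scale `τ` -/

section Translation

variable {n : ℕ} {M : Type*} [TopologicalSpace M] [ChartedSpace (EuclideanSpace ℝ (Fin n)) M]
  [IsManifold (𝓡 n) ∞ M] [T3Space M] [MeasurableSpace M] [BorelSpace M]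
  {g : PseudoRiemannianMetric (𝓡 n) ∞ (EuclideanSpace ℝ (Fin n)) (TangentSpace (𝓡 n) : M → Type _)}
  [g.HasLeviCivita] {f : M → ℝ}

/-- **From the all-scales inequality in relative-entropy form to Perelman's `𝒲`-form at scale `τ`**
(the computation of Carrillo–Ni 2009, §4, p. 9, with the scale kept): on a normalised gradient
shrinker (`Ric + Hess f = g/2`, `R + |∇f|² = f`, so `Δf = n/2 − R`), for a smooth `ψ` compatible at
scale `τ` with density `u = (4πτ)^{-n/2} e^{-ψ}`, integrable `f u, ψ u, R u, |∇ψ|² u, g⁻¹(df, dψ) u`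
and the integration by parts `∫ g⁻¹(df, dψ) u = ∫ u Δf`, the inequality
`∫ (f + c − ψ) u ≤ τ ∫ |∇(f − ψ)|² u + (1 − τ)(∫ f u − n)` gives `c ≤ 𝒲(g, ψ, τ)`:
`∫ |∇(f − ψ)|² u = ∫ f u + ∫ R u + ∫ |∇ψ|² u − n`. [cite: LiWang2020, Thm. 1.1 and (4.3)–(4.4)]
[cite: CarrilloNi2009, §4, derivation of (4.1) from Thm. 3.1] -/
theorem log_le_wEntropy_of_asei (hnorm : ∀ x : M, g.scalarCurvature x + g.gradSq f x = f x)
    (hsol : ∀ (x : M) (X Y : TangentSpace (𝓡 n) x),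
      g.ricci x X Y + g.hessian f x X Y = (1 / 2 : ℝ) * g.val x X Y)
    (hf : ContMDiff (𝓡 n) 𝓘(ℝ, ℝ) ∞ f) {τ : ℝ} {ψ : M → ℝ} (hψ : ContMDiff (𝓡 n) 𝓘(ℝ, ℝ) ∞ ψ)
    (hψc : g.IsEntropyCompatible ψ τ)
    (hfu : Integrable (fun x ↦ f x * entropyDensity n ψ τ x) g.riemVolume)
    (hψu : Integrable (fun x ↦ ψ x * entropyDensity n ψ τ x) g.riemVolume)
    (hSu : Integrable (fun x ↦ g.scalarCurvature x * entropyDensity n ψ τ x) g.riemVolume)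
    (hgradu : Integrable (fun x ↦ g.gradSq ψ x * entropyDensity n ψ τ x) g.riemVolume)
    (hcrossu : Integrable (fun x ↦ g.innerDual x (mvfderiv (𝓡 n) f x).toLinearMap
      (mvfderiv (𝓡 n) ψ x).toLinearMap * entropyDensity n ψ τ x) g.riemVolume)
    (hibp : ∫ x, g.innerDual x (mvfderiv (𝓡 n) f x).toLinearMap
        (mvfderiv (𝓡 n) ψ x).toLinearMap * entropyDensity n ψ τ x ∂g.riemVolume =
      ∫ x, g.dalembertian f x * entropyDensity n ψ τ x ∂g.riemVolume)
    {c : ℝ}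
    (hasei : ∫ x, (f x + c - ψ x) * entropyDensity n ψ τ x ∂g.riemVolume ≤
      τ * ∫ x, g.gradSq (fun y ↦ f y - ψ y) x * entropyDensity n ψ τ x ∂g.riemVolume
        + (1 - τ) * (∫ x, f x * entropyDensity n ψ τ x ∂g.riemVolume - n)) :
    c ≤ g.wEntropy g.leviCivita ψ τ := by
  -- unit mass and integrability of `u`
  have h1 : ∫ x, entropyDensity n ψ τ x ∂g.riemVolume = 1 := by
    have := hψc
    rw [PseudoRiemannianMetric.isEntropyCompatible_iff, finrank_euclideanSpace_fin] at this
    exact this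
  have huI : Integrable (entropyDensity n ψ τ) g.riemVolume := by
    by_contra hni
    rw [integral_undef hni] at h1
    exact zero_ne_one h1
  -- the soliton identities
  have hgradf : ∀ x, g.gradSq f x = f x - g.scalarCurvature x := fun x ↦ by linarith [hnorm x]
  have hΔf : ∀ x, g.dalembertian f x = n / 2 - g.scalarCurvature x := fun x ↦ by
    linarith [scalarCurvature_add_dalembertian hsol x]
  -- `∫ g⁻¹(df, dψ) u = n/2 - ∫ R u`
  have hcross_val : ∫ x, g.innerDual x (mvfderiv (𝓡 n) f x).toLinearMap
      (mvfderiv (𝓡 n) ψ x).toLinearMap * entropyDensity n ψ τ x ∂g.riemVolume =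
      n / 2 - ∫ x, g.scalarCurvature x * entropyDensity n ψ τ x ∂g.riemVolume := by
    rw [hibp]
    have : ∀ x, g.dalembertian f x * entropyDensity n ψ τ x =
        (n : ℝ) / 2 * entropyDensity n ψ τ x - g.scalarCurvature x * entropyDensity n ψ τ x :=
      fun x ↦ by rw [hΔf x]; ring
    simp_rw [this]
    rw [integral_sub (huI.const_mul _) hSu, integral_const_mul, h1, mul_one]
  -- `∫ |∇(f - ψ)|² u = ∫ f u + ∫ R u + ∫ |∇ψ|² u - n`
  have hI : ∫ x, g.gradSq (fun y ↦ f y - ψ y) x * entropyDensity n ψ τ x ∂g.riemVolume =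
      ∫ x, f x * entropyDensity n ψ τ x ∂g.riemVolume +
        ∫ x, g.scalarCurvature x * entropyDensity n ψ τ x ∂g.riemVolume +
        ∫ x, g.gradSq ψ x * entropyDensity n ψ τ x ∂g.riemVolume - n := by
    have hpt : ∀ x, g.gradSq (fun y ↦ f y - ψ y) x * entropyDensity n ψ τ x =
        (f x * entropyDensity n ψ τ x - g.scalarCurvature x * entropyDensity n ψ τ x) -
          2 * (g.innerDual x (mvfderiv (𝓡 n) f x).toLinearMap
            (mvfderiv (𝓡 n) ψ x).toLinearMap * entropyDensity n ψ τ x) +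
          g.gradSq ψ x * entropyDensity n ψ τ x := fun x ↦ by
      rw [gradSq_sub (hf.mdifferentiableAt (by norm_num)) (hψ.mdifferentiableAt (by norm_num)),
        hgradf x]
      ring
    simp_rw [hpt]
    have iA : Integrable (fun x ↦ f x * entropyDensity n ψ τ x -
        g.scalarCurvature x * entropyDensity n ψ τ x) g.riemVolume := hfu.sub hSu
    have iB : Integrable (fun x ↦ 2 * (g.innerDual x (mvfderiv (𝓡 n) f x).toLinearMap
        (mvfderiv (𝓡 n) ψ x).toLinearMap * entropyDensity n ψ τ x)) g.riemVolume :=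
      hcrossu.const_mul 2
    have iC : Integrable (fun x ↦ (f x * entropyDensity n ψ τ x -
        g.scalarCurvature x * entropyDensity n ψ τ x) -
        2 * (g.innerDual x (mvfderiv (𝓡 n) f x).toLinearMap
          (mvfderiv (𝓡 n) ψ x).toLinearMap * entropyDensity n ψ τ x)) g.riemVolume := iA.sub iB
    rw [integral_add iC hgradu, integral_sub iA iB, integral_sub hfu hSu, integral_const_mul,
      hcross_val]
    ring
  -- `H = ∫ f u + c - ∫ ψ u`
  have hH : ∫ x, (f x + c - ψ x) * entropyDensity n ψ τ x ∂g.riemVolume =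
      ∫ x, f x * entropyDensity n ψ τ x ∂g.riemVolume + c -
        ∫ x, ψ x * entropyDensity n ψ τ x ∂g.riemVolume := by
    have hpt : ∀ x, (f x + c - ψ x) * entropyDensity n ψ τ x =
        f x * entropyDensity n ψ τ x + c * entropyDensity n ψ τ x -
          ψ x * entropyDensity n ψ τ x := fun x ↦ by ring
    simp_rw [hpt]
    have iu : Integrable (fun x ↦ c * entropyDensity n ψ τ x) g.riemVolume := huI.const_mul c
    have iA : Integrable (fun x ↦ f x * entropyDensity n ψ τ x + c * entropyDensity n ψ τ x)
        g.riemVolume := hfu.add iu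
    rw [integral_sub iA hψu, integral_add hfu iu, integral_const_mul, h1, mul_one]
  -- `𝒲(g, ψ, τ) = τ ∫ R u + τ ∫ |∇ψ|² u + ∫ ψ u - n`
  have hW : g.wEntropy g.leviCivita ψ τ =
      τ * ∫ x, g.scalarCurvature x * entropyDensity n ψ τ x ∂g.riemVolume +
        τ * ∫ x, g.gradSq ψ x * entropyDensity n ψ τ x ∂g.riemVolume +
        ∫ x, ψ x * entropyDensity n ψ τ x ∂g.riemVolume - n := by
    rw [PseudoRiemannianMetric.wEntropy_def, finrank_euclideanSpace_fin]
    have hpt : ∀ x, (τ * (g.scalarCurvatureWith g.leviCivita x + g.gradSq ψ x) + ψ x - (n : ℕ)) *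
        entropyDensity n ψ τ x =
        τ * (g.scalarCurvature x * entropyDensity n ψ τ x) +
          τ * (g.gradSq ψ x * entropyDensity n ψ τ x) +
          ψ x * entropyDensity n ψ τ x - (n : ℝ) * entropyDensity n ψ τ x := fun x ↦ by
      rw [PseudoRiemannianMetric.scalarCurvatureWith_leviCivita]
      ring
    simp_rw [hpt]
    have iu : Integrable (fun x ↦ (n : ℝ) * entropyDensity n ψ τ x) g.riemVolume :=
      huI.const_mul _
    have i1 : Integrable (fun x ↦ τ * (g.scalarCurvature x * entropyDensity n ψ τ x)) g.riemVolume :=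
      hSu.const_mul τ
    have i2 : Integrable (fun x ↦ τ * (g.gradSq ψ x * entropyDensity n ψ τ x)) g.riemVolume :=
      hgradu.const_mul τ
    have iA : Integrable (fun x ↦ τ * (g.scalarCurvature x * entropyDensity n ψ τ x) +
        τ * (g.gradSq ψ x * entropyDensity n ψ τ x)) g.riemVolume := i1.add i2
    have iB : Integrable (fun x ↦ τ * (g.scalarCurvature x * entropyDensity n ψ τ x) +
        τ * (g.gradSq ψ x * entropyDensity n ψ τ x) + ψ x * entropyDensity n ψ τ x)
        g.riemVolume := iA.add hψu
    rw [integral_sub iB iu, integral_add iA hψu, integral_add i1 i2, integral_const_mul,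
      integral_const_mul, integral_const_mul, h1, mul_one]
  rw [hI, hH] at hasei
  rw [hW]
  nlinarith [hasei]

end Translation

/-! ### The degenerate case `n = 0` -/

section DimZero

variable {n : ℕ} {M : Type*} [TopologicalSpace M] [ChartedSpace (EuclideanSpace ℝ (Fin n)) M]
  [IsManifold (𝓡 n) ∞ M] [ConnectedSpace M] [T3Space M] [MeasurableSpace M] [BorelSpace M]
  {g : PseudoRiemannianMetric (𝓡 n) ∞ (EuclideanSpace ℝ (Fin n)) (TangentSpace (𝓡 n) : M → Type _)}
  [g.HasLeviCivita] {f : M → ℝ}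

/-- **The all-scales inequality in dimension `0`**: a connected manifold modelled on `ℝ⁰` is a
point `p` (`HaslhoferMuller.subsingleton_of_finrank_eq_zero`), all gradients and the scalar curvature
vanish, so `f = R + |∇f|² = 0`; with `m = Vol(M)`, compatibility reads `e^{-ψ(p)} m = 1`, and both
sides equal `log m = ψ(p)`. [folklore] -/
theorem log_le_wEntropy_of_dim_zero (hn : n = 0)
    (hnorm : ∀ x : M, g.scalarCurvature x + g.gradSq f x = f x) {τ : ℝ} {ψ : M → ℝ}
    (hψc : g.IsEntropyCompatible ψ τ) :
    Real.log ((4 * Real.pi) ^ (-(n : ℝ) / 2) * ∫ x, Real.exp (-f x) ∂g.riemVolume) ≤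
      g.wEntropy g.leviCivita ψ τ := by
  have hfin : finrank ℝ (EuclideanSpace ℝ (Fin n)) = 0 := by rw [finrank_euclideanSpace_fin, hn]
  haveI hE0 : Subsingleton (EuclideanSpace ℝ (Fin n)) := Module.finrank_zero_iff.1 hfin
  haveI : Subsingleton M :=
    HaslhoferMuller.subsingleton_of_finrank_eq_zero (E := EuclideanSpace ℝ (Fin n)) (M := M) hfin
  haveI : Nonempty M := ConnectedSpace.toNonempty
  obtain ⟨p⟩ := ‹Nonempty M›
  have hT : ∀ x : M, Subsingleton (TangentSpace (𝓡 n) x) := fun _ ↦ hE0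
  -- tangent-space quantities vanish
  have hgrad0 : ∀ (F : M → ℝ) (x : M), g.gradSq F x = 0 := by
    intro F x
    haveI := hT x
    show (mvfderiv (𝓡 n) F x).toLinearMap (g.sharp x (mvfderiv (𝓡 n) F x).toLinearMap) = 0
    rw [Subsingleton.elim (g.sharp x (mvfderiv (𝓡 n) F x).toLinearMap) 0, map_zero]
  have hR0 : ∀ x : M, g.scalarCurvature x = 0 := by
    intro x
    haveI := hT x
    show LinearMap.trace ℝ _ ((g.sharp x).toLinearMap ∘ₗ (g.ricci x)) = 0
    rw [show ((g.sharp x).toLinearMap ∘ₗ (g.ricci x) :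
        TangentSpace (𝓡 n) x →ₗ[ℝ] TangentSpace (𝓡 n) x) = 0 from
      LinearMap.ext fun v ↦ Subsingleton.elim _ _, map_zero]
  have hRw0 : ∀ x : M, g.scalarCurvatureWith g.leviCivita x = 0 := fun x ↦ by
    rw [PseudoRiemannianMetric.scalarCurvatureWith_leviCivita, hR0 x]
  have hf0 : ∀ x, f x = 0 := fun x ↦ by linarith [hnorm x, hR0 x, hgrad0 f x]
  -- integrals over the point
  set m : ℝ := ∫ x, (1 : ℝ) ∂g.riemVolume with hmdef
  have hint : ∀ F : M → ℝ, ∫ x, F x ∂g.riemVolume = F p * m := by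
    intro F
    calc ∫ x, F x ∂g.riemVolume = ∫ x, F p * (1 : ℝ) ∂g.riemVolume :=
          integral_congr_ae (ae_of_all _ fun x ↦ by rw [Subsingleton.elim x p, mul_one])
      _ = F p * m := integral_const_mul _ _
  -- the normalising constants are `1`
  have hn0 : (-(n : ℝ) / 2) = 0 := by rw [hn]; simp
  have hu : ∀ x, entropyDensity n ψ τ x = Real.exp (-ψ x) := fun x ↦ by
    rw [entropyDensity_apply, hn0, Real.rpow_zero, one_mul]
  -- compatibility: `e^{-ψ p} m = 1`
  have h1 : Real.exp (-ψ p) * m = 1 := by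
    have := hψc
    rw [PseudoRiemannianMetric.isEntropyCompatible_iff, finrank_euclideanSpace_fin, hint] at this
    rwa [hu p] at this
  have hm : m = Real.exp (ψ p) :=
    calc m = Real.exp (ψ p) * (Real.exp (-ψ p) * m) := by
          rw [← mul_assoc, ← Real.exp_add, add_neg_cancel, Real.exp_zero, one_mul]
      _ = Real.exp (ψ p) := by rw [h1, mul_one]
  -- both sides are `ψ p`
  have hl : Real.log ((4 * Real.pi) ^ (-(n : ℝ) / 2) * ∫ x, Real.exp (-f x) ∂g.riemVolume) = ψ p := by
    rw [hn0, Real.rpow_zero, one_mul, hint, hf0 p, neg_zero, Real.exp_zero, one_mul, hm, Real.log_exp]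
  have hr : g.wEntropy g.leviCivita ψ τ = ψ p := by
    rw [PseudoRiemannianMetric.wEntropy_def, finrank_euclideanSpace_fin, hint, hRw0 p, hgrad0 ψ p,
      hu p, hn]
    push_cast
    have : ψ p * Real.exp (-ψ p) * m = ψ p := by
      rw [mul_assoc, h1, mul_one]
    linear_combination this
  rw [hl, hr]

end DimZero

end LiWang2020

/-! ### The fact from the weighted heat semigroup -/

/-- **`LiWang2020_shrinkerLSI_allScales` follows from the heat semigroup of the complete weighted
manifold with its strong gradient bound** (`weightedHeatSemigroup_strongGradientBound_complete`,
Bakry–Gentil–Ledoux 2014, Thm. 3.2.4 + Thm. 3.2.6 — the linear parabolic theory of Li–Wang's §§2–3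
in semigroup form). On a complete connected normalised gradient shrinker: `R ≥ 0`
(`shrinkerScalarCurvature_nonneg_holds`), `f` is proper (Haslhofer–Müller growth), `e^{-f}`,
`f e^{-f} ∈ L¹`; for the probability potential `V = f + log ∫ e^{-f}` (`Ric + Hess V = g/2`) the
semigroup of `(M, g, e^{-V} dV)` gives, by the static-frame Perelman monotonicity
`shrinker_asei_eventuallyConst_of_semigroup` and the density step
`shrinker_asei_of_asei_eventuallyConst`, the all-scales inequality for
`φ = f + log Θ − ψ − (n/2) log τ` (`e^{φ − V} = (4πτ)^{-n/2} e^{-ψ} = u`), which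
`LiWang2020.log_le_wEntropy_of_asei` turns into `log Θ ≤ 𝒲(g, ψ, τ)`; `n = 0` is
`LiWang2020.log_le_wEntropy_of_dim_zero`.
[cite: LiWang2020, Thm. 1.1, Prop. 5.9 and Lemma 5.10 (arXiv:1901.05691, pp. 3, 20)]
[cite: BakryGentilLedoux2014, Thm. 3.2.4 (p. 144) and Prop. 5.7.1 (p. 268)] -/
theorem LiWang2020_shrinkerLSI_allScales_of_heatSemigroup
    (h : weightedHeatSemigroup_strongGradientBound_complete) : LiWang2020_shrinkerLSI_allScales := by
  intro n M _ _ _ _ _ _ _ _ _ g _ f hg hc hf hsol hnorm τ hτ ψ hψ hcompat hmom hfisher hint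
  classical
  rcases Nat.eq_zero_or_pos n with hn0 | hn
  · exact LiWang2020.log_le_wEntropy_of_dim_zero hn0 hnorm hcompat
  have hc' : ∀ (x : M) (r : NNReal), IsCompact {y : M | g.edist hg x y ≤ r} := fun x r ↦ by
    simpa only [PseudoRiemannianMetric.riemEDist_eq hg] using hc x r
  /- `R ≥ 0`, a minimum point, the growth of `f`, properness, `e^{-f}, f e^{-f} ∈ L¹` -/
  have hS0 : ∀ x, 0 ≤ g.scalarCurvature x :=
    shrinkerScalarCurvature_nonneg_holds n M g f hg hc' hf hsol hnorm
  have hgradle : ∀ x, g.gradSq f x ≤ f x := fun x ↦ by linarith [hS0 x, hnorm x]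
  have hf0 : ∀ x, 0 ≤ f x := fun x ↦ (g.gradSq_nonneg hg f x).trans (hgradle x)
  have hk1 : ((1 : ℕ∞) : ℕ∞ω) + 1 ≤ (∞ : ℕ∞ω) := by
    rw [show ((1 : ℕ∞) : ℕ∞ω) + 1 = 2 by norm_num]
    exact WithTop.coe_le_coe.2 le_top
  haveI : CovariantDerivative.ContMDiffCovariantDerivative g.leviCivita 1 :=
    ⟨g.isLocallyContMDiff_leviCivita_holds 1 hk1 univ isOpen_univ⟩
  haveI : CovariantDerivative.ContMDiffCovariantDerivative g.leviCivita ∞ :=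
    ⟨g.isLocallyContMDiff_leviCivita_holds ⊤ (le_of_eq rfl) univ isOpen_univ⟩
  obtain ⟨p, hp⟩ := HaslhoferMuller.exists_forall_potential_le g hg hc' hf hgradle hsol
  have hlow : ∀ (x : M) (r : NNReal), (r : ℝ≥0∞) ≤ g.edist hg p x →
      (1 / 4 : ℝ) * (max ((r : ℝ) - 5 * n) 0) ^ 2 ≤ f x := fun x r hr ↦ by
    have h := HaslhoferMuller.potential_lower_of_scalarCurvature_nonneg g hg hc' hf hsol hnorm
      hS0 hp x r hr
    rwa [finrank_euclideanSpace_fin] at h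
  haveI : Nonempty M := ⟨p⟩
  have hprop : ∀ c : ℝ, IsCompact {x | f x ≤ c} := by
    intro c
    set r : NNReal := Real.toNNReal (5 * n + 2 * Real.sqrt |c| + 2) with hrdef
    have hr : c < (1 / 4 : ℝ) * (max ((r : ℝ) - 5 * n) 0) ^ 2 := by
      have hr' : (r : ℝ) - 5 * n = 2 * Real.sqrt |c| + 2 := by
        rw [hrdef, Real.coe_toNNReal _ (by positivity)]; ring
      rw [hr', max_eq_left (by positivity)]
      nlinarith [Real.sq_sqrt (abs_nonneg c), le_abs_self c, Real.sqrt_nonneg |c|]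
    have hsub : {x | f x ≤ c} ⊆ {y : M | g.edist hg p y ≤ r} := by
      intro x hx
      by_contra hxr
      have h1 := hlow x r (le_of_lt (not_le.1 hxr))
      have h2 : f x ≤ c := hx
      linarith
    exact (hc' p r).of_isClosed_subset (isClosed_le hf.continuous continuous_const) hsub
  obtain ⟨hexpI, hfexpI⟩ := integrable_exp_neg_of_proper hg hf hsol hnorm hprop
  /- the constants `I₀ = ∫ e^{-f}`, `A = (4π)^{-n/2}`, `Θ = A I₀`, `c = log Θ` -/
  set I₀ : ℝ := ∫ x, Real.exp (-f x) ∂g.riemVolume with hI₀def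
  set A : ℝ := (4 * Real.pi) ^ (-(n : ℝ) / 2) with hAdef
  have hApos : 0 < A := Real.rpow_pos_of_pos (by positivity) _
  have hΘpos : 0 < A * I₀ := theta_pos hg hexpI
  have hI₀pos : 0 < I₀ := pos_of_mul_pos_right hΘpos hApos.le
  set c : ℝ := Real.log (A * I₀) with hcdef
  have hcA : c = Real.log A + Real.log I₀ := by rw [hcdef, Real.log_mul hApos.ne' hI₀pos.ne']
  /- the probability potential `V = f + log I₀` and the semigroup -/
  set L : ℝ := Real.log I₀ with hLdef
  set V : M → ℝ := fun x ↦ f x + L with hVdef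
  have hVs : ContMDiff (𝓡 n) 𝓘(ℝ, ℝ) ∞ V := hf.add contMDiff_const
  have heV : ∀ x, Real.exp (-V x) = Real.exp (-f x) * I₀⁻¹ := fun x ↦ by
    simp only [hVdef]
    rw [neg_add, Real.exp_add, Real.exp_neg L, hLdef, Real.exp_log hI₀pos]
  have hwI : Integrable (fun x ↦ Real.exp (-V x)) g.riemVolume := by
    simp_rw [heV]; exact hexpI.mul_const _
  have hmassV : ∫ x, Real.exp (-V x) ∂g.riemVolume = 1 := by
    simp_rw [heV]
    rw [integral_mul_const, mul_inv_cancel₀ hI₀pos.ne']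
  have hfwV : Integrable (fun x ↦ f x * Real.exp (-V x)) g.riemVolume := by
    simp_rw [heV, ← mul_assoc]; exact hfexpI.mul_const _
  have hRicV : ∀ (x : M) (X : TangentSpace (𝓡 n) x),
      (1 / 2 : ℝ) * g.val x X X ≤ g.ricci x X X + g.hessian V x X X := by
    intro x X
    rw [show V = fun y ↦ f y + L from rfl, hessian_add_const_apply hf L x X X]
    exact (hsol x X X).symm.le
  obtain ⟨P, hPlin, hPpos, hPcont, hPone, hPinv, hPflow⟩ := h n M g V (1 / 2) hg hc hVs hRicV hwI
  have hw0 : ∀ x, 0 ≤ Real.exp (-V x) := fun x ↦ (Real.exp_pos _).le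
  have hwc : Continuous fun x ↦ Real.exp (-V x) := Real.continuous_exp.comp hVs.continuous.neg
  /- the inequality for densities constant outside a compact set, and its extension -/
  have hcore : ∀ θ : M → ℝ, ContMDiff (𝓡 n) 𝓘(ℝ, ℝ) ∞ θ →
      (∃ K : Set M, IsCompact K ∧ ∃ c : ℝ, ∀ x, x ∉ K → θ x = c) →
      ∫ x, Real.exp (θ x) * Real.exp (-V x) ∂g.riemVolume = 1 →
      ∫ x, θ x * (Real.exp (θ x) * Real.exp (-V x)) ∂g.riemVolume ≤
        τ * ∫ x, g.gradSq θ x * (Real.exp (θ x) * Real.exp (-V x)) ∂g.riemVolume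
          + (1 - τ) * (∫ x, f x * (Real.exp (θ x) * Real.exp (-V x)) ∂g.riemVolume - n)
          - n / 2 * Real.log τ := fun θ hθ hθK hθmass ↦
    shrinker_asei_eventuallyConst_of_semigroup hg hc' hn hf hsol hnorm hS0 hprop (V := V) (cV := L)
      (fun x ↦ rfl) hmassV hfwV P hPlin hPpos hPone hPinv hPflow hτ θ hθ hθK hθmass
  /- the density `u` of `ψ` at scale `τ`, as the density of `ψ' = ψ + (n/2) log τ` at scale `1` -/
  set u : M → ℝ := entropyDensity n ψ τ with hudef
  set ψ' : M → ℝ := fun x ↦ ψ x + (n : ℝ) / 2 * Real.log τ with hψ'def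
  have hψ's : ContMDiff (𝓡 n) 𝓘(ℝ, ℝ) ∞ ψ' := hψ.add contMDiff_const
  have hu' : ∀ x, entropyDensity n ψ' 1 x = u x := by
    intro x
    simp only [hudef, entropyDensity_apply, mul_one, hψ'def]
    rw [Real.mul_rpow (by positivity : (0 : ℝ) ≤ 4 * Real.pi) hτ.le,
      show -(ψ x + (n : ℝ) / 2 * Real.log τ) = Real.log τ * (-(n : ℝ) / 2) + -ψ x by ring,
      Real.exp_add, ← Real.rpow_def_of_pos hτ]
    ring
  have hufun : entropyDensity n ψ' 1 = u := funext hu'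
  have hux : ∀ x, entropyDensity n ψ' 1 x = A * Real.exp (-ψ' x) := fun x ↦ by
    simp only [entropyDensity_apply, mul_one, hAdef]
  have hupos : ∀ x, 0 < u x := fun x ↦ entropyDensity_pos n ψ hτ x
  have hucont : Continuous u := continuous_const.mul (Real.continuous_exp.comp hψ.continuous.neg)
  have hu1 : ∫ x, u x ∂g.riemVolume = 1 := by
    have := hcompat
    rw [PseudoRiemannianMetric.isEntropyCompatible_iff, finrank_euclideanSpace_fin] at this
    exact this
  have huI : Integrable u g.riemVolume := by
    by_contra hni; rw [integral_undef hni] at hu1; exact zero_ne_one hu1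
  have hdψ : ∀ x, mvfderiv (𝓡 n) ψ' x = mvfderiv (𝓡 n) ψ x := fun x ↦
    mvfderiv_add_const_eq hψ _ x
  /- the test function `φ = f + c − ψ'`, `e^{φ − V} = u` -/
  set c' : ℝ := c - (n : ℝ) / 2 * Real.log τ with hc'def
  set φ : M → ℝ := fun x ↦ (f x - ψ x) + c' with hφdef
  have hφs : ContMDiff (𝓡 n) 𝓘(ℝ, ℝ) ∞ φ := (hf.sub hψ).add contMDiff_const
  have hφV : ∀ x, Real.exp (φ x) * Real.exp (-V x) = u x := by
    intro x
    rw [← hu' x, hux x, ← Real.exp_add]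
    have : φ x + -V x = Real.log A + -ψ' x := by
      simp only [hφdef, hVdef, hψ'def, hc'def, hLdef]
      rw [hcA]
      ring
    rw [this, Real.exp_add, Real.exp_log hApos]
  have hφmass : ∫ x, Real.exp (φ x) * Real.exp (-V x) ∂g.riemVolume = 1 := by
    simp_rw [hφV]; exact hu1
  /- integrability on the fact's class -/
  obtain ⟨o, ho⟩ := hmom
  obtain ⟨hfu, hSu⟩ := integrable_potential_mul_of_secondMoment hg hf hnorm (B := 0)
    (fun x ↦ by rw [neg_zero]; exact hS0 x) hucont (fun x ↦ (hupos x).le) huI ho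
  have hψu : Integrable (fun x ↦ ψ x * u x) g.riemVolume := by
    refine ((hint.sub ((hSu.const_mul τ).add (hfisher.const_mul τ))).add
      (huI.const_mul (n : ℝ))).congr (Eventually.of_forall fun x ↦ ?_)
    simp only [Pi.add_apply, Pi.sub_apply, hudef]
    ring
  have hgradfu : Integrable (fun x ↦ g.gradSq f x * u x) g.riemVolume := by
    refine (hfu.sub hSu).congr (Eventually.of_forall fun x ↦ ?_)
    show f x * u x - g.scalarCurvature x * u x = g.gradSq f x * u x
    rw [← sub_mul]
    congr 1
    linarith [hnorm x]
  have hgradcont : ∀ {F : M → ℝ}, ContMDiff (𝓡 n) 𝓘(ℝ, ℝ) ∞ F → Continuous (g.gradSq F) :=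
    fun hF ↦ continuous_innerDual_mvfderiv g (hF.of_le (by norm_num)) (hF.of_le (by norm_num))
  have hgradφ : ∀ x, g.gradSq φ x = g.gradSq (fun y ↦ f y - ψ y) x := fun x ↦
    CarrilloNi2009_shrinkerLSI.gradSq_add_const c' ((hf.sub hψ).mdifferentiableAt (by norm_num))
  have hmaj : Integrable (fun x ↦ 2 * (g.gradSq f x * u x + g.gradSq ψ x * u x)) g.riemVolume :=
    (hgradfu.add hfisher).const_mul 2
  have hFisher' : Integrable (fun x ↦ g.gradSq (fun y ↦ f y - ψ y) x * u x) g.riemVolume := by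
    refine hmaj.mono' (((hgradcont (hf.sub hψ)).mul hucont).aestronglyMeasurable)
      (Eventually.of_forall fun x ↦ ?_)
    have hcs := abs_innerDual_mvfderiv_le hg f ψ x
    have hsub := CarrilloNi2009_shrinkerLSI.gradSq_sub (g := g)
      (hf.mdifferentiableAt (by norm_num) (x := x)) (hψ.mdifferentiableAt (by norm_num))
    have hnn : 0 ≤ g.gradSq (fun y ↦ f y - ψ y) x := g.gradSq_nonneg hg _ x
    rw [Real.norm_eq_abs, abs_mul, abs_of_nonneg (hupos x).le, abs_of_nonneg hnn, hsub]
    have h1 := (abs_le.1 hcs).1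
    nlinarith [mul_nonneg (show 0 ≤ g.gradSq f x + g.gradSq ψ x + 2 * g.innerDual x
      (mvfderiv (𝓡 n) f x).toLinearMap (mvfderiv (𝓡 n) ψ x).toLinearMap by linarith) (hupos x).le]
  have hIφ : Integrable (fun x ↦ g.gradSq φ x * (Real.exp (φ x) * Real.exp (-V x))) g.riemVolume := by
    simp_rw [hφV, hgradφ]; exact hFisher'
  have hEφ : Integrable (fun x ↦ φ x * (Real.exp (φ x) * Real.exp (-V x))) g.riemVolume := by
    simp_rw [hφV]
    refine (((hfu.sub hψu).add (huI.const_mul c'))).congr (Eventually.of_forall fun x ↦ ?_)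
    simp only [Pi.add_apply, Pi.sub_apply, hφdef]
    ring
  have hFφ : Integrable (fun x ↦ f x * (Real.exp (φ x) * Real.exp (-V x))) g.riemVolume := by
    simp_rw [hφV]; exact hfu
  /- the all-scales inequality for `φ` -/
  have hred := shrinker_asei_of_asei_eventuallyConst hg hc' g.riemVolume hwc hw0 hwI hf.continuous
    hf0 hfwV hτ hcore hφs hφmass hIφ hEφ hFφ
  have hl : ∫ x, φ x * (Real.exp (φ x) * Real.exp (-V x)) ∂g.riemVolume =
      ∫ x, (f x + c - ψ x) * u x ∂g.riemVolume - (n : ℝ) / 2 * Real.log τ := by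
    have hpt : ∀ x, φ x * (Real.exp (φ x) * Real.exp (-V x)) =
        (f x + c - ψ x) * u x - (n : ℝ) / 2 * Real.log τ * u x := fun x ↦ by
      rw [hφV]; simp only [hφdef, hc'def]; ring
    simp_rw [hpt]
    have i1 : Integrable (fun x ↦ (f x + c - ψ x) * u x) g.riemVolume := by
      refine ((hfu.add (huI.const_mul c)).sub hψu).congr (Eventually.of_forall fun x ↦ ?_)
      simp only [Pi.add_apply, Pi.sub_apply]
      ring
    have i2 : Integrable (fun x ↦ (n : ℝ) / 2 * Real.log τ * u x) g.riemVolume := huI.const_mul _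
    rw [integral_sub i1 i2, integral_const_mul, hu1, mul_one]
  have hr1 : ∫ x, g.gradSq φ x * (Real.exp (φ x) * Real.exp (-V x)) ∂g.riemVolume =
      ∫ x, g.gradSq (fun y ↦ f y - ψ y) x * u x ∂g.riemVolume :=
    integral_congr_ae (ae_of_all _ fun x ↦ by beta_reduce; rw [hφV, hgradφ])
  have hr2 : ∫ x, f x * (Real.exp (φ x) * Real.exp (-V x)) ∂g.riemVolume =
      ∫ x, f x * u x ∂g.riemVolume :=
    integral_congr_ae (ae_of_all _ fun x ↦ by beta_reduce; rw [hφV])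
  rw [hl, hr1, hr2] at hred
  have hasei : ∫ x, (f x + c - ψ x) * u x ∂g.riemVolume ≤
      τ * ∫ x, g.gradSq (fun y ↦ f y - ψ y) x * u x ∂g.riemVolume
        + (1 - τ) * (∫ x, f x * u x ∂g.riemVolume - n) := by linarith
  /- the cross term and the integration by parts of §4 (at scale `1` for `ψ'`) -/
  have hcrossu : Integrable (fun x ↦ g.innerDual x (mvfderiv (𝓡 n) f x).toLinearMap
      (mvfderiv (𝓡 n) ψ x).toLinearMap * u x) g.riemVolume := by
    have hmeas : Continuous (fun x ↦ g.innerDual x (mvfderiv (𝓡 n) f x).toLinearMap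
        (mvfderiv (𝓡 n) ψ x).toLinearMap * u x) :=
      (continuous_innerDual_mvfderiv (g := g) (hf.of_le (by norm_num))
        (hψ.of_le (by norm_num))).mul hucont
    have hmaj' : Integrable (fun x ↦ 1 / 2 * (g.gradSq f x * u x + g.gradSq ψ x * u x))
        g.riemVolume := (hgradfu.add hfisher).const_mul (1 / 2)
    refine hmaj'.mono hmeas.aestronglyMeasurable (Eventually.of_forall fun x ↦ ?_)
    have hcs := abs_innerDual_mvfderiv_le hg f ψ x
    have h0 : 0 ≤ 1 / 2 * (g.gradSq f x * u x + g.gradSq ψ x * u x) := by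
      have := g.gradSq_nonneg hg f x
      have := g.gradSq_nonneg hg ψ x
      have := hupos x
      positivity
    rw [Real.norm_eq_abs, Real.norm_eq_abs, abs_mul, abs_of_nonneg (hupos x).le, abs_of_nonneg h0]
    nlinarith [hupos x]
  have huI' : Integrable (entropyDensity n ψ' 1) g.riemVolume := by rw [hufun]; exact huI
  have hSu' : Integrable (fun x ↦ g.scalarCurvature x * entropyDensity n ψ' 1 x) g.riemVolume := by
    rw [hufun]; exact hSu
  have hfu' : Integrable (fun x ↦ f x * entropyDensity n ψ' 1 x) g.riemVolume := by
    rw [hufun]; exact hfu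
  have hcrossu' : Integrable (fun x ↦ g.innerDual x (mvfderiv (𝓡 n) f x).toLinearMap
      (mvfderiv (𝓡 n) ψ' x).toLinearMap * entropyDensity n ψ' 1 x) g.riemVolume := by
    rw [hufun]; simp_rw [hdψ]; exact hcrossu
  have hibp' := integral_innerDual_mul_density_eq hg hf hsol hnorm hprop hψ's huI' hSu' hfu' hcrossu'
  rw [hufun] at hibp'
  simp_rw [hdψ] at hibp'
  exact LiWang2020.log_le_wEntropy_of_asei hnorm hsol hf hψ hcompat hfu hψu hSu hfisher hcrossu
    hibp' hasei

/-! ### The fact from ANY weighted heat flow of the shrinker -/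

namespace LiWang2020

/-- **Li–Wang's Thm. 1.1 on one shrinker, from its weighted heat flow.** Let `(M, g, f)` be a
complete connected normalised gradient shrinker (`Ric + Hess f = g/2`, `R + |∇f|² = f`, closed
`g`-balls compact) and ASSUME the weighted heat flow `∂ₜu = Δu − g⁻¹(df, du)` exists for every
smooth positive initial density `ρ₀` constant outside a compact set, as a function jointly smooth on
`M × [0, ∞)` with the a-priori properties of the linear parabolic theory of Li–Wang's §§2–3 (values in
the range `[a, b]` of `ρ₀` — maximum principle; `|Lu|` bounded; Bakry–Émery gradient decay
`|∇u(t)|² ≤ e^{-t}C`; conservation of `∫ u e^{-f}`). Then for every `τ > 0` and every smooth `ψ`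
compatible at scale `τ` with finite second moment, finite Fisher information and integrable
`𝒲`-integrand, `log ((4π)^{-n/2} ∫ e^{-f}) ≤ 𝒲(g, ψ, τ)` — the conclusion of
`LiWang2020_shrinkerLSI_allScales` for this shrinker. Proof: as
`LiWang2020_shrinkerLSI_allScales_of_heatSemigroup`, with the static-frame Perelman monotonicity
`shrinker_asei_eventuallyConst_of_flow` fed by the assumed flow of `e^θ` for the probability potential
`V = f + log ∫ e^{-f}` (`dV = df`, `∫ u e^{-V} = 1`), the density step
`shrinker_asei_of_asei_eventuallyConst` and `log_le_wEntropy_of_asei`; `n = 0` is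
`log_le_wEntropy_of_dim_zero`. The flow hypothesis is discharged by the semigroup of
`weightedHeatSemigroup_strongGradientBound_complete`, or by any solution theory of the linear heat
equation on the complete weighted manifold `(M, g, e^{-f})` with maximum principle, mass conservation
and gradient bound.
[cite: LiWang2020, Thm. 1.1, Prop. 5.9 and Lemma 5.10 (arXiv:1901.05691, pp. 3, 20); §§2–3 for the flow] -/
theorem log_le_wEntropy_of_heatFlow {n : ℕ} {M : Type} [TopologicalSpace M] [T2Space M]
    [SecondCountableTopology M] [ChartedSpace (EuclideanSpace ℝ (Fin n)) M] [IsManifold (𝓡 n) ∞ M]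
    [ConnectedSpace M] [T3Space M] [MeasurableSpace M] [BorelSpace M]
    {g : PseudoRiemannianMetric (𝓡 n) ∞ (EuclideanSpace ℝ (Fin n)) (TangentSpace (𝓡 n) : M → Type _)}
    [g.HasLeviCivita] {f : M → ℝ} (hg : g.IsRiemannian)
    (hc : ∀ (x : M) (r : NNReal), IsCompact {y : M | g.riemEDist x y ≤ r})
    (hf : ContMDiff (𝓡 n) 𝓘(ℝ, ℝ) ∞ f)
    (hsol : ∀ (x : M) (X Y : TangentSpace (𝓡 n) x),
      g.ricci x X Y + g.hessian f x X Y = (1 / 2 : ℝ) * g.val x X Y)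
    (hnorm : ∀ x : M, g.scalarCurvature x + g.gradSq f x = f x)
    (hflow : (∀ (ρ₀ : M → ℝ), ContMDiff (𝓡 n) 𝓘(ℝ, ℝ) ∞ ρ₀ →
        (∃ K₀ : Set M, IsCompact K₀ ∧ ∃ c₀ : ℝ, ∀ x, x ∉ K₀ → ρ₀ x = c₀) →
        ∀ (a b : ℝ), 0 < a → (∀ x, a ≤ ρ₀ x ∧ ρ₀ x ≤ b) →
        ∃ u : ℝ → M → ℝ,
          ContMDiffOn ((𝓡 n).prod 𝓘(ℝ, ℝ)) 𝓘(ℝ, ℝ) ∞ (fun p : M × ℝ ↦ u p.2 p.1) (univ ×ˢ Ici 0) ∧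
          u 0 = ρ₀ ∧
          (∀ t ∈ Ici (0 : ℝ), ∀ x, derivWithin (fun s ↦ u s x) (Ici 0) t =
            g.dalembertian (u t) x
              - g.innerDual x (mvfderiv (𝓡 n) f x : TangentSpace (𝓡 n) x →ₗ[ℝ] ℝ)
                  (mvfderiv (𝓡 n) (u t) x : TangentSpace (𝓡 n) x →ₗ[ℝ] ℝ)) ∧
          (∀ t ∈ Ici (0 : ℝ), ∀ x, a ≤ u t x ∧ u t x ≤ b) ∧
          (∃ CL : ℝ, ∀ t ∈ Ici (0 : ℝ), ∀ x, |g.dalembertian (u t) x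
            - g.innerDual x (mvfderiv (𝓡 n) f x : TangentSpace (𝓡 n) x →ₗ[ℝ] ℝ)
                (mvfderiv (𝓡 n) (u t) x : TangentSpace (𝓡 n) x →ₗ[ℝ] ℝ)| ≤ CL) ∧
          (∃ CΓ : ℝ, ∀ t ∈ Ici (0 : ℝ), ∀ x, g.gradSq (u t) x ≤ Real.exp (-t) * CΓ) ∧
          (∀ t ∈ Ici (0 : ℝ), ∫ x, u t x * Real.exp (-f x) ∂g.riemVolume =
            ∫ x, ρ₀ x * Real.exp (-f x) ∂g.riemVolume)))
    {τ : ℝ} (hτ : 0 < τ) {ψ : M → ℝ} (hψ : ContMDiff (𝓡 n) 𝓘(ℝ, ℝ) ∞ ψ)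
    (hcompat : g.IsEntropyCompatible ψ τ)
    (hmom : ∃ o : M, Integrable (fun x ↦ (g.riemEDist o x).toReal ^ 2 * entropyDensity n ψ τ x)
      g.riemVolume)
    (hfisher : Integrable (fun x ↦ g.gradSq ψ x * entropyDensity n ψ τ x) g.riemVolume)
    (hint : Integrable (fun x ↦ (τ * (g.scalarCurvature x + g.gradSq ψ x) + ψ x - n) *
      entropyDensity n ψ τ x) g.riemVolume) :
    Real.log ((4 * Real.pi) ^ (-(n : ℝ) / 2) * ∫ x, Real.exp (-f x) ∂g.riemVolume) ≤
      g.wEntropy g.leviCivita ψ τ := by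
  classical
  rcases Nat.eq_zero_or_pos n with hn0 | hn
  · exact LiWang2020.log_le_wEntropy_of_dim_zero hn0 hnorm hcompat
  have hc' : ∀ (x : M) (r : NNReal), IsCompact {y : M | g.edist hg x y ≤ r} := fun x r ↦ by
    simpa only [PseudoRiemannianMetric.riemEDist_eq hg] using hc x r
  /- `R ≥ 0`, a minimum point, the growth of `f`, properness, `e^{-f}, f e^{-f} ∈ L¹` -/
  have hS0 : ∀ x, 0 ≤ g.scalarCurvature x :=
    shrinkerScalarCurvature_nonneg_holds n M g f hg hc' hf hsol hnorm
  have hgradle : ∀ x, g.gradSq f x ≤ f x := fun x ↦ by linarith [hS0 x, hnorm x]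
  have hf0 : ∀ x, 0 ≤ f x := fun x ↦ (g.gradSq_nonneg hg f x).trans (hgradle x)
  have hk1 : ((1 : ℕ∞) : ℕ∞ω) + 1 ≤ (∞ : ℕ∞ω) := by
    rw [show ((1 : ℕ∞) : ℕ∞ω) + 1 = 2 by norm_num]
    exact WithTop.coe_le_coe.2 le_top
  haveI : CovariantDerivative.ContMDiffCovariantDerivative g.leviCivita 1 :=
    ⟨g.isLocallyContMDiff_leviCivita_holds 1 hk1 univ isOpen_univ⟩
  haveI : CovariantDerivative.ContMDiffCovariantDerivative g.leviCivita ∞ :=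
    ⟨g.isLocallyContMDiff_leviCivita_holds ⊤ (le_of_eq rfl) univ isOpen_univ⟩
  obtain ⟨p, hp⟩ := HaslhoferMuller.exists_forall_potential_le g hg hc' hf hgradle hsol
  have hlow : ∀ (x : M) (r : NNReal), (r : ℝ≥0∞) ≤ g.edist hg p x →
      (1 / 4 : ℝ) * (max ((r : ℝ) - 5 * n) 0) ^ 2 ≤ f x := fun x r hr ↦ by
    have h := HaslhoferMuller.potential_lower_of_scalarCurvature_nonneg g hg hc' hf hsol hnorm
      hS0 hp x r hr
    rwa [finrank_euclideanSpace_fin] at h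
  haveI : Nonempty M := ⟨p⟩
  have hprop : ∀ c : ℝ, IsCompact {x | f x ≤ c} := by
    intro c
    set r : NNReal := Real.toNNReal (5 * n + 2 * Real.sqrt |c| + 2) with hrdef
    have hr : c < (1 / 4 : ℝ) * (max ((r : ℝ) - 5 * n) 0) ^ 2 := by
      have hr' : (r : ℝ) - 5 * n = 2 * Real.sqrt |c| + 2 := by
        rw [hrdef, Real.coe_toNNReal _ (by positivity)]; ring
      rw [hr', max_eq_left (by positivity)]
      nlinarith [Real.sq_sqrt (abs_nonneg c), le_abs_self c, Real.sqrt_nonneg |c|]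
    have hsub : {x | f x ≤ c} ⊆ {y : M | g.edist hg p y ≤ r} := by
      intro x hx
      by_contra hxr
      have h1 := hlow x r (le_of_lt (not_le.1 hxr))
      have h2 : f x ≤ c := hx
      linarith
    exact (hc' p r).of_isClosed_subset (isClosed_le hf.continuous continuous_const) hsub
  obtain ⟨hexpI, hfexpI⟩ := integrable_exp_neg_of_proper hg hf hsol hnorm hprop
  /- the constants `I₀ = ∫ e^{-f}`, `A = (4π)^{-n/2}`, `Θ = A I₀`, `c = log Θ` -/
  set I₀ : ℝ := ∫ x, Real.exp (-f x) ∂g.riemVolume with hI₀def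
  set A : ℝ := (4 * Real.pi) ^ (-(n : ℝ) / 2) with hAdef
  have hApos : 0 < A := Real.rpow_pos_of_pos (by positivity) _
  have hΘpos : 0 < A * I₀ := theta_pos hg hexpI
  have hI₀pos : 0 < I₀ := pos_of_mul_pos_right hΘpos hApos.le
  set c : ℝ := Real.log (A * I₀) with hcdef
  have hcA : c = Real.log A + Real.log I₀ := by rw [hcdef, Real.log_mul hApos.ne' hI₀pos.ne']
  /- the probability potential `V = f + log I₀` and the semigroup -/
  set L : ℝ := Real.log I₀ with hLdef
  set V : M → ℝ := fun x ↦ f x + L with hVdef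
  have hVs : ContMDiff (𝓡 n) 𝓘(ℝ, ℝ) ∞ V := hf.add contMDiff_const
  have heV : ∀ x, Real.exp (-V x) = Real.exp (-f x) * I₀⁻¹ := fun x ↦ by
    simp only [hVdef]
    rw [neg_add, Real.exp_add, Real.exp_neg L, hLdef, Real.exp_log hI₀pos]
  have hwI : Integrable (fun x ↦ Real.exp (-V x)) g.riemVolume := by
    simp_rw [heV]; exact hexpI.mul_const _
  have hmassV : ∫ x, Real.exp (-V x) ∂g.riemVolume = 1 := by
    simp_rw [heV]
    rw [integral_mul_const, mul_inv_cancel₀ hI₀pos.ne']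
  have hfwV : Integrable (fun x ↦ f x * Real.exp (-V x)) g.riemVolume := by
    simp_rw [heV, ← mul_assoc]; exact hfexpI.mul_const _
  have hw0 : ∀ x, 0 ≤ Real.exp (-V x) := fun x ↦ (Real.exp_pos _).le
  have hwc : Continuous fun x ↦ Real.exp (-V x) := Real.continuous_exp.comp hVs.continuous.neg
  /- the inequality for densities constant outside a compact set, and its extension -/
  have hcore : ∀ θ : M → ℝ, ContMDiff (𝓡 n) 𝓘(ℝ, ℝ) ∞ θ →
      (∃ K : Set M, IsCompact K ∧ ∃ c : ℝ, ∀ x, x ∉ K → θ x = c) →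
      ∫ x, Real.exp (θ x) * Real.exp (-V x) ∂g.riemVolume = 1 →
      ∫ x, θ x * (Real.exp (θ x) * Real.exp (-V x)) ∂g.riemVolume ≤
        τ * ∫ x, g.gradSq θ x * (Real.exp (θ x) * Real.exp (-V x)) ∂g.riemVolume
          + (1 - τ) * (∫ x, f x * (Real.exp (θ x) * Real.exp (-V x)) ∂g.riemVolume - n)
          - n / 2 * Real.log τ := by
    intro θ hθ hθK hθmass
    obtain ⟨K₀, hK₀, cθ, hcθ⟩ := hθK
    -- the datum `e^θ`, its range `[e^{-C}, e^{C}]`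
    set ρ₀ : M → ℝ := fun x ↦ Real.exp (θ x) with hρ₀def
    have hρ₀ : ContMDiff (𝓡 n) 𝓘(ℝ, ℝ) ∞ ρ₀ := Real.contDiff_exp.comp_contMDiff hθ
    have hρ₀K : ∃ K₀ : Set M, IsCompact K₀ ∧ ∃ c₀ : ℝ, ∀ x, x ∉ K₀ → ρ₀ x = c₀ :=
      ⟨K₀, hK₀, Real.exp cθ, fun x hx ↦ by simp only [hρ₀def, hcθ x hx]⟩
    obtain ⟨Cθ, hCθ⟩ := exists_forall_abs_le_of_eventuallyConst hθ.continuous ⟨K₀, hK₀, cθ, hcθ⟩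
    have ha : 0 < Real.exp (-Cθ) := Real.exp_pos _
    have hρ₀ab : ∀ x, Real.exp (-Cθ) ≤ ρ₀ x ∧ ρ₀ x ≤ Real.exp Cθ := fun x ↦
      ⟨Real.exp_le_exp.2 (neg_le_of_abs_le (hCθ x)), Real.exp_le_exp.2 (le_of_abs_le (hCθ x))⟩
    -- the flow and its a-priori properties
    obtain ⟨u, hu, hu0, hueq, hab, ⟨CL, hLu⟩, ⟨CΓ, hGdecay⟩, hmassu⟩ :=
      hflow ρ₀ hρ₀ hρ₀K (Real.exp (-Cθ)) (Real.exp Cθ) ha hρ₀ab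
    have hdV : ∀ x, mvfderiv (𝓡 n) V x = mvfderiv (𝓡 n) f x := fun x ↦
      mvfderiv_add_const_eq hf L x
    have hueqV : ∀ t ∈ Ici (0 : ℝ), ∀ x, derivWithin (fun s ↦ u s x) (Ici 0) t =
        g.dalembertian (u t) x
          - g.innerDual x (mvfderiv (𝓡 n) V x : TangentSpace (𝓡 n) x →ₗ[ℝ] ℝ)
              (mvfderiv (𝓡 n) (u t) x : TangentSpace (𝓡 n) x →ₗ[ℝ] ℝ) := fun t ht x ↦ by
      rw [hdV x]; exact hueq t ht x
    have hLuV : ∀ t ∈ Ici (0 : ℝ), ∀ x, |g.dalembertian (u t) x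
        - g.innerDual x (mvfderiv (𝓡 n) V x : TangentSpace (𝓡 n) x →ₗ[ℝ] ℝ)
            (mvfderiv (𝓡 n) (u t) x : TangentSpace (𝓡 n) x →ₗ[ℝ] ℝ)| ≤ CL := fun t ht x ↦ by
      rw [hdV x]; exact hLu t ht x
    have hmassuV : ∀ t ∈ Ici (0 : ℝ), ∫ x, u t x * Real.exp (-V x) ∂g.riemVolume = 1 := by
      intro t ht
      have h1 : ∫ x, u t x * Real.exp (-V x) ∂g.riemVolume =
          (∫ x, u t x * Real.exp (-f x) ∂g.riemVolume) * I₀⁻¹ := by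
        rw [← integral_mul_const]
        exact integral_congr_ae (Eventually.of_forall fun x ↦ by
          show u t x * Real.exp (-V x) = u t x * Real.exp (-f x) * I₀⁻¹
          rw [heV x, mul_assoc])
      have h2 : ∫ x, Real.exp (θ x) * Real.exp (-V x) ∂g.riemVolume =
          (∫ x, ρ₀ x * Real.exp (-f x) ∂g.riemVolume) * I₀⁻¹ := by
        rw [← integral_mul_const]
        exact integral_congr_ae (Eventually.of_forall fun x ↦ by
          show Real.exp (θ x) * Real.exp (-V x) = ρ₀ x * Real.exp (-f x) * I₀⁻¹
          rw [heV x, hρ₀def, mul_assoc])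
      rw [h1, hmassu t ht, ← h2, hθmass]
    exact shrinker_asei_eventuallyConst_of_flow hg hc' hn hf hsol hnorm hS0 hprop (V := V) (cV := L)
      (fun x ↦ rfl) hmassV hfwV u hu hueqV ha hab hLuV hGdecay hmassuV hτ θ hθ hu0
  /- the density `u` of `ψ` at scale `τ`, as the density of `ψ' = ψ + (n/2) log τ` at scale `1` -/
  set u : M → ℝ := entropyDensity n ψ τ with hudef
  set ψ' : M → ℝ := fun x ↦ ψ x + (n : ℝ) / 2 * Real.log τ with hψ'def
  have hψ's : ContMDiff (𝓡 n) 𝓘(ℝ, ℝ) ∞ ψ' := hψ.add contMDiff_const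
  have hu' : ∀ x, entropyDensity n ψ' 1 x = u x := by
    intro x
    simp only [hudef, entropyDensity_apply, mul_one, hψ'def]
    rw [Real.mul_rpow (by positivity : (0 : ℝ) ≤ 4 * Real.pi) hτ.le,
      show -(ψ x + (n : ℝ) / 2 * Real.log τ) = Real.log τ * (-(n : ℝ) / 2) + -ψ x by ring,
      Real.exp_add, ← Real.rpow_def_of_pos hτ]
    ring
  have hufun : entropyDensity n ψ' 1 = u := funext hu'
  have hux : ∀ x, entropyDensity n ψ' 1 x = A * Real.exp (-ψ' x) := fun x ↦ by
    simp only [entropyDensity_apply, mul_one, hAdef]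
  have hupos : ∀ x, 0 < u x := fun x ↦ entropyDensity_pos n ψ hτ x
  have hucont : Continuous u := continuous_const.mul (Real.continuous_exp.comp hψ.continuous.neg)
  have hu1 : ∫ x, u x ∂g.riemVolume = 1 := by
    have := hcompat
    rw [PseudoRiemannianMetric.isEntropyCompatible_iff, finrank_euclideanSpace_fin] at this
    exact this
  have huI : Integrable u g.riemVolume := by
    by_contra hni; rw [integral_undef hni] at hu1; exact zero_ne_one hu1
  have hdψ : ∀ x, mvfderiv (𝓡 n) ψ' x = mvfderiv (𝓡 n) ψ x := fun x ↦
    mvfderiv_add_const_eq hψ _ x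
  /- the test function `φ = f + c − ψ'`, `e^{φ − V} = u` -/
  set c' : ℝ := c - (n : ℝ) / 2 * Real.log τ with hc'def
  set φ : M → ℝ := fun x ↦ (f x - ψ x) + c' with hφdef
  have hφs : ContMDiff (𝓡 n) 𝓘(ℝ, ℝ) ∞ φ := (hf.sub hψ).add contMDiff_const
  have hφV : ∀ x, Real.exp (φ x) * Real.exp (-V x) = u x := by
    intro x
    rw [← hu' x, hux x, ← Real.exp_add]
    have : φ x + -V x = Real.log A + -ψ' x := by
      simp only [hφdef, hVdef, hψ'def, hc'def, hLdef]
      rw [hcA]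
      ring
    rw [this, Real.exp_add, Real.exp_log hApos]
  have hφmass : ∫ x, Real.exp (φ x) * Real.exp (-V x) ∂g.riemVolume = 1 := by
    simp_rw [hφV]; exact hu1
  /- integrability on the fact's class -/
  obtain ⟨o, ho⟩ := hmom
  obtain ⟨hfu, hSu⟩ := integrable_potential_mul_of_secondMoment hg hf hnorm (B := 0)
    (fun x ↦ by rw [neg_zero]; exact hS0 x) hucont (fun x ↦ (hupos x).le) huI ho
  have hψu : Integrable (fun x ↦ ψ x * u x) g.riemVolume := by
    refine ((hint.sub ((hSu.const_mul τ).add (hfisher.const_mul τ))).add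
      (huI.const_mul (n : ℝ))).congr (Eventually.of_forall fun x ↦ ?_)
    simp only [Pi.add_apply, Pi.sub_apply, hudef]
    ring
  have hgradfu : Integrable (fun x ↦ g.gradSq f x * u x) g.riemVolume := by
    refine (hfu.sub hSu).congr (Eventually.of_forall fun x ↦ ?_)
    show f x * u x - g.scalarCurvature x * u x = g.gradSq f x * u x
    rw [← sub_mul]
    congr 1
    linarith [hnorm x]
  have hgradcont : ∀ {F : M → ℝ}, ContMDiff (𝓡 n) 𝓘(ℝ, ℝ) ∞ F → Continuous (g.gradSq F) :=
    fun hF ↦ continuous_innerDual_mvfderiv g (hF.of_le (by norm_num)) (hF.of_le (by norm_num))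
  have hgradφ : ∀ x, g.gradSq φ x = g.gradSq (fun y ↦ f y - ψ y) x := fun x ↦
    CarrilloNi2009_shrinkerLSI.gradSq_add_const c' ((hf.sub hψ).mdifferentiableAt (by norm_num))
  have hmaj : Integrable (fun x ↦ 2 * (g.gradSq f x * u x + g.gradSq ψ x * u x)) g.riemVolume :=
    (hgradfu.add hfisher).const_mul 2
  have hFisher' : Integrable (fun x ↦ g.gradSq (fun y ↦ f y - ψ y) x * u x) g.riemVolume := by
    refine hmaj.mono' (((hgradcont (hf.sub hψ)).mul hucont).aestronglyMeasurable)
      (Eventually.of_forall fun x ↦ ?_)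
    have hcs := abs_innerDual_mvfderiv_le hg f ψ x
    have hsub := CarrilloNi2009_shrinkerLSI.gradSq_sub (g := g)
      (hf.mdifferentiableAt (by norm_num) (x := x)) (hψ.mdifferentiableAt (by norm_num))
    have hnn : 0 ≤ g.gradSq (fun y ↦ f y - ψ y) x := g.gradSq_nonneg hg _ x
    rw [Real.norm_eq_abs, abs_mul, abs_of_nonneg (hupos x).le, abs_of_nonneg hnn, hsub]
    have h1 := (abs_le.1 hcs).1
    nlinarith [mul_nonneg (show 0 ≤ g.gradSq f x + g.gradSq ψ x + 2 * g.innerDual x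
      (mvfderiv (𝓡 n) f x).toLinearMap (mvfderiv (𝓡 n) ψ x).toLinearMap by linarith) (hupos x).le]
  have hIφ : Integrable (fun x ↦ g.gradSq φ x * (Real.exp (φ x) * Real.exp (-V x))) g.riemVolume := by
    simp_rw [hφV, hgradφ]; exact hFisher'
  have hEφ : Integrable (fun x ↦ φ x * (Real.exp (φ x) * Real.exp (-V x))) g.riemVolume := by
    simp_rw [hφV]
    refine (((hfu.sub hψu).add (huI.const_mul c'))).congr (Eventually.of_forall fun x ↦ ?_)
    simp only [Pi.add_apply, Pi.sub_apply, hφdef]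
    ring
  have hFφ : Integrable (fun x ↦ f x * (Real.exp (φ x) * Real.exp (-V x))) g.riemVolume := by
    simp_rw [hφV]; exact hfu
  /- the all-scales inequality for `φ` -/
  have hred := shrinker_asei_of_asei_eventuallyConst hg hc' g.riemVolume hwc hw0 hwI hf.continuous
    hf0 hfwV hτ hcore hφs hφmass hIφ hEφ hFφ
  have hl : ∫ x, φ x * (Real.exp (φ x) * Real.exp (-V x)) ∂g.riemVolume =
      ∫ x, (f x + c - ψ x) * u x ∂g.riemVolume - (n : ℝ) / 2 * Real.log τ := by
    have hpt : ∀ x, φ x * (Real.exp (φ x) * Real.exp (-V x)) =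
        (f x + c - ψ x) * u x - (n : ℝ) / 2 * Real.log τ * u x := fun x ↦ by
      rw [hφV]; simp only [hφdef, hc'def]; ring
    simp_rw [hpt]
    have i1 : Integrable (fun x ↦ (f x + c - ψ x) * u x) g.riemVolume := by
      refine ((hfu.add (huI.const_mul c)).sub hψu).congr (Eventually.of_forall fun x ↦ ?_)
      simp only [Pi.add_apply, Pi.sub_apply]
      ring
    have i2 : Integrable (fun x ↦ (n : ℝ) / 2 * Real.log τ * u x) g.riemVolume := huI.const_mul _
    rw [integral_sub i1 i2, integral_const_mul, hu1, mul_one]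
  have hr1 : ∫ x, g.gradSq φ x * (Real.exp (φ x) * Real.exp (-V x)) ∂g.riemVolume =
      ∫ x, g.gradSq (fun y ↦ f y - ψ y) x * u x ∂g.riemVolume :=
    integral_congr_ae (ae_of_all _ fun x ↦ by beta_reduce; rw [hφV, hgradφ])
  have hr2 : ∫ x, f x * (Real.exp (φ x) * Real.exp (-V x)) ∂g.riemVolume =
      ∫ x, f x * u x ∂g.riemVolume :=
    integral_congr_ae (ae_of_all _ fun x ↦ by beta_reduce; rw [hφV])
  rw [hl, hr1, hr2] at hred
  have hasei : ∫ x, (f x + c - ψ x) * u x ∂g.riemVolume ≤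
      τ * ∫ x, g.gradSq (fun y ↦ f y - ψ y) x * u x ∂g.riemVolume
        + (1 - τ) * (∫ x, f x * u x ∂g.riemVolume - n) := by linarith
  /- the cross term and the integration by parts of §4 (at scale `1` for `ψ'`) -/
  have hcrossu : Integrable (fun x ↦ g.innerDual x (mvfderiv (𝓡 n) f x).toLinearMap
      (mvfderiv (𝓡 n) ψ x).toLinearMap * u x) g.riemVolume := by
    have hmeas : Continuous (fun x ↦ g.innerDual x (mvfderiv (𝓡 n) f x).toLinearMap
        (mvfderiv (𝓡 n) ψ x).toLinearMap * u x) :=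
      (continuous_innerDual_mvfderiv (g := g) (hf.of_le (by norm_num))
        (hψ.of_le (by norm_num))).mul hucont
    have hmaj' : Integrable (fun x ↦ 1 / 2 * (g.gradSq f x * u x + g.gradSq ψ x * u x))
        g.riemVolume := (hgradfu.add hfisher).const_mul (1 / 2)
    refine hmaj'.mono hmeas.aestronglyMeasurable (Eventually.of_forall fun x ↦ ?_)
    have hcs := abs_innerDual_mvfderiv_le hg f ψ x
    have h0 : 0 ≤ 1 / 2 * (g.gradSq f x * u x + g.gradSq ψ x * u x) := by
      have := g.gradSq_nonneg hg f x
      have := g.gradSq_nonneg hg ψ x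
      have := hupos x
      positivity
    rw [Real.norm_eq_abs, Real.norm_eq_abs, abs_mul, abs_of_nonneg (hupos x).le, abs_of_nonneg h0]
    nlinarith [hupos x]
  have huI' : Integrable (entropyDensity n ψ' 1) g.riemVolume := by rw [hufun]; exact huI
  have hSu' : Integrable (fun x ↦ g.scalarCurvature x * entropyDensity n ψ' 1 x) g.riemVolume := by
    rw [hufun]; exact hSu
  have hfu' : Integrable (fun x ↦ f x * entropyDensity n ψ' 1 x) g.riemVolume := by
    rw [hufun]; exact hfu
  have hcrossu' : Integrable (fun x ↦ g.innerDual x (mvfderiv (𝓡 n) f x).toLinearMap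
      (mvfderiv (𝓡 n) ψ' x).toLinearMap * entropyDensity n ψ' 1 x) g.riemVolume := by
    rw [hufun]; simp_rw [hdψ]; exact hcrossu
  have hibp' := integral_innerDual_mul_density_eq hg hf hsol hnorm hprop hψ's huI' hSu' hfu' hcrossu'
  rw [hufun] at hibp'
  simp_rw [hdψ] at hibp'
  exact LiWang2020.log_le_wEntropy_of_asei hnorm hsol hf hψ hcompat hfu hψu hSu hfisher hcrossu
    hibp' hasei

end LiWang2020

/-- **`LiWang2020_shrinkerLSI_allScales` follows from the existence of the weighted heat flow on
complete shrinkers** — `LiWang2020.log_le_wEntropy_of_heatFlow` quantified over all shrinkers: the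
analytic input is, for every complete connected normalised gradient shrinker `(M, g, f)` and every
smooth positive datum `ρ₀` constant outside a compact set, a solution `u` of
`∂ₜu = Δu − g⁻¹(df, du)`, `u(0) = ρ₀`, jointly smooth on `M × [0, ∞)`, with values in the range
`[a, b]` of `ρ₀`, `|Lu|` bounded, `|∇u(t)|² ≤ e^{-t}C` and `∫ u(t) e^{-f} = ∫ ρ₀ e^{-f}` (the linear
parabolic theory of Li–Wang's §§2–3; supplied e.g. by `weightedHeatSemigroup_strongGradientBound_complete`,
cf. `LiWang2020_shrinkerLSI_allScales_of_heatSemigroup`).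
[cite: LiWang2020, Thm. 1.1, Prop. 5.9 and Lemma 5.10 (arXiv:1901.05691, pp. 3, 20); §§2–3 for the flow] -/
theorem LiWang2020_shrinkerLSI_allScales_of_heatFlow
    (hflow : ∀ (n : ℕ) (M : Type) [TopologicalSpace M] [T2Space M] [SecondCountableTopology M]
      [ChartedSpace (EuclideanSpace ℝ (Fin n)) M] [IsManifold (𝓡 n) ∞ M] [ConnectedSpace M]
      [T3Space M] [MeasurableSpace M] [BorelSpace M]
      (g : PseudoRiemannianMetric (𝓡 n) ∞ (EuclideanSpace ℝ (Fin n)) (TangentSpace (𝓡 n) : M → Type _))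
      [g.HasLeviCivita] (f : M → ℝ), g.IsRiemannian →
      (∀ (x : M) (r : NNReal), IsCompact {y : M | g.riemEDist x y ≤ r}) →
      ContMDiff (𝓡 n) 𝓘(ℝ, ℝ) ∞ f →
      (∀ (x : M) (X Y : TangentSpace (𝓡 n) x),
        g.ricci x X Y + g.hessian f x X Y = (1 / 2 : ℝ) * g.val x X Y) →
      (∀ x : M, g.scalarCurvature x + g.gradSq f x = f x) →
      (∀ (ρ₀ : M → ℝ), ContMDiff (𝓡 n) 𝓘(ℝ, ℝ) ∞ ρ₀ →
      (∃ K₀ : Set M, IsCompact K₀ ∧ ∃ c₀ : ℝ, ∀ x, x ∉ K₀ → ρ₀ x = c₀) →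
      ∀ (a b : ℝ), 0 < a → (∀ x, a ≤ ρ₀ x ∧ ρ₀ x ≤ b) →
      ∃ u : ℝ → M → ℝ,
        ContMDiffOn ((𝓡 n).prod 𝓘(ℝ, ℝ)) 𝓘(ℝ, ℝ) ∞ (fun p : M × ℝ ↦ u p.2 p.1) (univ ×ˢ Ici 0) ∧
        u 0 = ρ₀ ∧
        (∀ t ∈ Ici (0 : ℝ), ∀ x, derivWithin (fun s ↦ u s x) (Ici 0) t =
          g.dalembertian (u t) x
            - g.innerDual x (mvfderiv (𝓡 n) f x : TangentSpace (𝓡 n) x →ₗ[ℝ] ℝ)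
                (mvfderiv (𝓡 n) (u t) x : TangentSpace (𝓡 n) x →ₗ[ℝ] ℝ)) ∧
        (∀ t ∈ Ici (0 : ℝ), ∀ x, a ≤ u t x ∧ u t x ≤ b) ∧
        (∃ CL : ℝ, ∀ t ∈ Ici (0 : ℝ), ∀ x, |g.dalembertian (u t) x
          - g.innerDual x (mvfderiv (𝓡 n) f x : TangentSpace (𝓡 n) x →ₗ[ℝ] ℝ)
              (mvfderiv (𝓡 n) (u t) x : TangentSpace (𝓡 n) x →ₗ[ℝ] ℝ)| ≤ CL) ∧
        (∃ CΓ : ℝ, ∀ t ∈ Ici (0 : ℝ), ∀ x, g.gradSq (u t) x ≤ Real.exp (-t) * CΓ) ∧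
        (∀ t ∈ Ici (0 : ℝ), ∫ x, u t x * Real.exp (-f x) ∂g.riemVolume =
          ∫ x, ρ₀ x * Real.exp (-f x) ∂g.riemVolume))) :
    LiWang2020_shrinkerLSI_allScales :=
  fun n M _ _ _ _ _ _ _ _ _ g _ f hg hc hf hsol hnorm _τ hτ _ψ hψ hcompat hmom hfisher hint ↦
    LiWang2020.log_le_wEntropy_of_heatFlow hg hc hf hsol hnorm (hflow n M g f hg hc hf hsol hnorm) hτ hψ
      hcompat hmom hfisher hint

end Literature.Geometry.Riemannian

end
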